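import Mathlib
import HarnessLib
import Literature.Analysis.FluidPDE.SelfSimilarLiouville
import Literature.Analysis.FluidPDE.SelfSimilarLiouvilleConsequences
import Literature.Analysis.FluidPDE.KNSSAxisymmetricNoSwirlHolds
import Literature.Analysis.FluidPDE.KNSSThm53OfWindow
import Literature.Analysis.FluidPDE.AncientAxisymmetricTypeILiouville
import Literature.Analysis.FluidPDE.LeiZhangZhao2017LiouvilleSwirlLp
import Literature.Analysis.FluidPDE.SelfSimilarLiouvilleSwirlDecayProofs
import Literature.Analysis.FluidPDE.LeiRenZhang2019Liouville
import Literature.Analysis.FluidPDE.LeiRenZhang2019PeriodicLiouville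
import Literature.Analysis.FluidPDE.LeiZhang2011
import Literature.Analysis.FluidPDE.LeiZhang2011Final
import Literature.Analysis.FluidPDE.KNSSLiouville
import Literature.Analysis.FluidPDE.KNSSLiouvillePlanarHolds
import Literature.Analysis.FluidPDE.GigaMiura2011BlowupAnalysis
import Literature.Analysis.FluidPDE.GigaMiura2011PlanarVorticityLiouvilleHolds
import Literature.Analysis.FluidPDE.GigaMiura2011UnidirectionalVorticityHolds
import Literature.Analysis.FluidPDE.AncientL3BackwardLiouville
import Literature.Analysis.FluidPDE.AncientL3BackwardLiouvilleHolds
import Literature.Analysis.FluidPDE.AncientWeakL3BackwardLiouvilleHolds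
import Literature.Analysis.FluidPDE.AncientLPSLiouville
import Literature.Analysis.FluidPDE.AncientLPSLiouvilleProofs
import Literature.Analysis.FluidPDE.LocalTypeI
import Literature.Analysis.FluidPDE.AlbrittonBarkerForwardHolds
import Literature.Analysis.FluidPDE.LiouvilleExcludesLocalTypeI
import Literature.Analysis.FluidPDE.TypeIAncientMild
import Literature.Analysis.FluidPDE.BeltramiFlows
import Literature.Analysis.FluidPDE.BeltramiFlowLiouville
import Summits.NavierStokesRegularity.NavierStokesRegularity.Theorems.LiouvilleConjectureNS
import Summits.NavierStokesRegularity.NavierStokesRegularity.Theorems.AxisymmetricLiouvilleBoundedSwirl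
import Summits.NavierStokesRegularity.NavierStokesRegularity.Theses.TypeILiouville
import Summits.NavierStokesRegularity.NavierStokesRegularity.Theses.GaldiLiouvilleGate
import Summits.NavierStokesRegularity.NavierStokesRegularity.Theses.EulerZoomLiouville
import Summits.NavierStokesRegularity.NavierStokesRegularity.Theorems.GaldiLiouvilleGateParabolicGaldiLiouvilleKnownCases
import Summits.NavierStokesRegularity.NavierStokesRegularity.Theorems.DssFarFieldSlavingBlowupTypeIDssProfileSimilarityEnstrophyTimeOnlyThreshold

/-!
# Blow-up scenario census, block A: ANCIENT / BACKWARD scenarios (Liouville side)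

Cell `pub/ns-census` (director-ns KEY req102, D-0154 (A), 2026-08-28), typer seat `ns-census-typer-2`.
Kernel-checked INDEX of block A of `SCENARIO-CENSUS.md` v1.1 (ns-census-lead; row keys fixed there, §2–§3):
solutions of Navier–Stokes on `ℝ³ × (−∞, 0)` with `ν = 1` — the objects every first-time singularity
zooms to (`Literature.Analysis.FluidPDE.KNSS2009_blowup_generates_ancient_holds`). Sister files:
`ScenarioCensusSteady.lean` (block S; this seat), `ScenarioCensusRotating.lean` (block R; this seat),
`ScenarioCensusForward.lean` / `ScenarioCensusSelfSimilar.lean` (blocks F / D; typer-1).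

## What a row is

`Row_<key> : Prop` is the exact Liouville / rigidity statement of census cell `<key>` ("this scenario
does not occur"), written over the tree predicates `IsBoundedAncientMildSolution`, `IsAncientMildSolution`,
`IsTypeIAncientMild`, `HasTypeIDecay`, `IsAxisymmetric`, `HasNoSwirl`, `swirl`, `cylRadius`, `IsBeltrami`,
`IsBoundedWeakNSSolutionOn` of `Literature.Analysis.FluidPDE`. When the tree already HOLDS the exact
statement — a `@[conjecture]` leaf, a route decl, or a named Literature fact — the row IS that
declaration by name (nothing restated). The census value is then decided by the kernel:
`EXCLUDED-IN-TREE` ⇔ `theorem row_<key>_excluded : Row_<key>` below (a one-line application of a tree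
theorem); `OPEN-…` rows have no such theorem, and the one-line implications `row_<j>_of_row_<k>` record
which open row contains which. Rows A7 (2.5D), A8 (helical) are NO-VOCAB (no tree predicate) and live
in the markdown only; "Type II × ancient" is the general bounded class of A1 (Type I = the decay classes
`IsTypeIAncientMild` / `HasTypeIDecay`).

| key | cell (type · symmetry · class) | `Row_…` body | value |
|---|---|---|---|
| A1 | any · none · bounded ancient mild | leaf `LiouvilleConjectureNS` (= item `TypeILiouville.TypeIliouvilleL` ⟨10661⟩) | OPEN-WITH-LINE |
| A2 | Type I · none · bounded mild, 𝐈 < ∞ | `¬ NontrivialMildAncientTypeIExists` (⇐ A1; ⇔ forward F1e) | OPEN-WITH-LINE |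
| A2a | Type I, rate constant C < 1 · none · `IsTypeIAncientMild C` | statement | EXCLUDED-IN-TREE |
| A2b | Type I (`HasTypeIDecay`) · axisym, swirl allowed · ancient mild | statement | EXCLUDED-IN-TREE |
| A2c / A2e | any · none · bounded continuous mild, L³ resp. weak-L³ along tₖ → −∞ | AB 2019 facts | EXCLUDED-IN-TREE |
| A2d | any · none · bounded weak ∩ L^l_t L^s_x (s > 3) | fact `Seregin2014_ancient_liouville_LPS` | EXCLUDED-IN-TREE |
| A3 | any · axisym no swirl · bounded mild | fact `knss_axisymmetric_no_swirl` | EXCLUDED-IN-TREE |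
| A4 | any · axisym, r‖u‖ ≤ C · bounded mild | fact `knss_bound_C_over_r` | EXCLUDED-IN-TREE |
| A5 | any · axisym swirl, Γ bounded · bounded mild | leaf `AxisymmetricLiouvilleBoundedSwirl` (⇐ A1) | OPEN-NO-LINE |
| A5a–A5e | Γ ∈ L^p / Γ → 0 / LRZ rate / BMO stream fn / z-periodic | LZZ 2017, LRZ 2019, Lei–Zhang 2011 facts | EXCLUDED-IN-TREE |
| A6 | any · planar 2D · bounded weak | fact `KNSS2009_liouville_planar` | EXCLUDED-IN-TREE |
| A9 | any · finite isometry group without fixed vector · bounded mild | statement (⇐ A1) | OPEN-NO-LINE |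
| A10a/b | Beltrami profile · decay o(1/‖x‖) resp. L^q, 2 ≤ q ≤ 3 | statements over `IsBeltrami` | EXCLUDED-IN-TREE |
| A11 | Type-II zoom object · none · power-gauged ancient Euler | item `EulerZoomLiouville.PowerGaugeEulerLiouville` ⟨19832⟩ | OPEN-WITH-LINE |
| A12 | any · none · bounded mild, smooth, bounded enstrophy, L⁶ | item `GaldiLiouvilleGate.ParabolicGaldiLiouville` ⟨0893⟩ (⇐ A1) | OPEN-WITH-LINE |

(A2e, A5e, A12 extend the lead's v1.1 keys: weak-L³ twin of A2c, z-periodic twin of A5c, the parabolic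
Galdi gate listed under S1 there.) No summit statement is proved or claimed here; nothing in this file is
a claim about Navier–Stokes regularity.
-/

noncomputable section

set_option linter.dupNamespace false

open MeasureTheory Set Filter Topology
open scoped ENNReal NNReal

namespace Summit.NavierStokesRegularity.NavierStokesRegularity.Theorems.ScenarioCensus

open Literature.Analysis

/-- Census row A1 — (any type · no symmetry · bounded ancient mild): the KNSS Liouville conjecture (L),
BY NAME the canonical leaf `Summit.NavierStokesRegularity.NavierStokesRegularity.LiouvilleConjectureNS`
(bounded ancient mild + measurable slices ⇒ every slice a.e. constant; KNSS 2009 §1, Seregin–Šverák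
2009 (L)). Value: OPEN-WITH-LINE (item ⟨10661⟩ `TypeILiouville.TypeIliouvilleL`, hard core). -/
def Row_A1 : Prop :=
  Summit.NavierStokesRegularity.NavierStokesRegularity.LiouvilleConjectureNS

/-- Row A1 is, definitionally, the route item `TypeILiouville.TypeIliouvilleL` (stmt-10661). -/
theorem row_A1_iff_item :
    Row_A1 ↔ Summit.NavierStokesRegularity.NavierStokesRegularity.Theses.TypeILiouville.TypeIliouvilleL :=
  Iff.rfl

/-- Census row A2 — (Type I · no symmetry · bounded ancient mild with `𝐈 < ∞`): no non-trivial mild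
bounded ancient solution with finite scale-invariant quantity `𝐈` exists — the negation of the open
existence statement `NontrivialMildAncientTypeIExists` (Albritton–Barker 2019 Thm 1.1, second bullet).
Value: OPEN-WITH-LINE (Type-I ancient Liouville programme: ⟨19708⟩, ⟨20428⟩, ⟨22508⟩, ⟨24453⟩; mechanism
rows TH / CalmSliceGate of the census §4). -/
def Row_A2 : Prop :=
  ¬ FluidPDE.NontrivialMildAncientTypeIExists

/-- A1 ⇒ A2 (tree theorem `not_nontrivialMildAncientTypeIExists_of_liouvilleConjectureNS`). -/
theorem row_A2_of_row_A1 (h : Row_A1) : Row_A2 :=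
  FluidPDE.not_nontrivialMildAncientTypeIExists_of_liouvilleConjectureNS h

/-- A2 ⇔ forward cell F1e "no suitable weak solution has a local Type I singular point", by the tree
theorem `AlbrittonBarkerTypeICharacterization_holds` (Albritton–Barker 2019 Thm 1.1). -/
theorem row_A2_iff_not_localTypeISingularityExists :
    Row_A2 ↔ ¬ FluidPDE.LocalTypeISingularityExists :=
  not_congr FluidPDE.AlbrittonBarkerTypeICharacterization_holds.symm

/-- Census row A2a — (Type I with TIME-rate constant `C < 1` · no symmetry · KNSS-gauge ancient mild
`IsTypeIAncientMild C V`, i.e. smooth, mild, `‖V(t,x)‖ ≤ C/√(−t)`): `V ≡ 0`. Value: EXCLUDED-IN-TREE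
(explicit-constant Type-I Liouville, pub-ns-dss; the `HasTypeIDecay` form with time constant `θ < 1`
is `SimilarityEnstrophy.typeI_ancient_eq_zero_of_timeConstant_lt_one`; forward twin F1a). -/
def Row_A2a : Prop :=
  ∀ C : ℝ, C < 1 → ∀ V : ℝ → EuclideanSpace ℝ (Fin 3) → EuclideanSpace ℝ (Fin 3),
    FluidPDE.IsTypeIAncientMild C V → ∀ t < 0, ∀ x, V t x = 0

/-- A2a is EXCLUDED-IN-TREE: `SimilarityEnstrophy.typeI_ancient_eq_zero_of_rate_lt_one`. -/
theorem row_A2a_excluded : Row_A2a :=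
  fun _ hC _ hV => SimilarityEnstrophy.typeI_ancient_eq_zero_of_rate_lt_one hV hC

/-- Census row A2b — (Type I, SPACE–time bound `‖u(t,x)‖ ≤ C₀/(‖x‖ + √(−t))` · axisymmetric, swirl
allowed · ancient mild with measurable slices): `u(t) = 0` a.e. for every `t < 0`. Value:
EXCLUDED-IN-TREE (corollary of KNSS 2009 Thm 5.3; note the space–time decay, not time-only Type I). -/
def Row_A2b : Prop :=
  ∀ u : ℝ → EuclideanSpace ℝ (Fin 3) → EuclideanSpace ℝ (Fin 3), FluidPDE.IsAncientMildSolution 1 u →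
    (∀ t < 0, AEStronglyMeasurable (u t) volume) → (∀ t < 0, FluidPDE.IsAxisymmetric (u t)) →
      (∃ C₀ : ℝ, FluidPDE.HasTypeIDecay C₀ u) → ∀ t < 0, u t =ᵐ[volume] 0

/-- A2b is EXCLUDED-IN-TREE: `IsAncientMildSolution.ae_eq_zero_of_isAxisymmetric_of_hasTypeIDecay`. -/
theorem row_A2b_excluded : Row_A2b :=
  fun _ hu hmeas haxi hdec => hdec.elim fun _ hC =>
    hu.ae_eq_zero_of_isAxisymmetric_of_hasTypeIDecay hmeas haxi hC

/-- Census row A2c — (any type · no symmetry · bounded continuous ancient mild solution with `‖v(tₖ)‖₃`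
bounded along `tₖ → −∞`): `v ≡ 0`, BY NAME the fact `AlbrittonBarker2019_liouville_L3_backward`
(contains the Escauriaza–Seregin–Šverák ancient class `L^∞_t L³_x`). Value: EXCLUDED-IN-TREE. -/
def Row_A2c : Prop :=
  FluidPDE.AlbrittonBarker2019_liouville_L3_backward

/-- A2c is EXCLUDED-IN-TREE: `AlbrittonBarker2019_liouville_L3_backward_holds`. -/
theorem row_A2c_excluded : Row_A2c :=
  FluidPDE.AlbrittonBarker2019_liouville_L3_backward_holds

/-- Census row A2e — weak-`L³` (`L^{3,∞}`) twin of A2c (level-set bound along `tₖ → −∞`, plus the caloric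
smallness / large-scale decay provisos of the tree rendering), BY NAME the fact
`AlbrittonBarker2019_liouville_weakL3_backward`. Value: EXCLUDED-IN-TREE. -/
def Row_A2e : Prop :=
  FluidPDE.AlbrittonBarker2019_liouville_weakL3_backward

/-- A2e is EXCLUDED-IN-TREE: `AlbrittonBarker2019_liouville_weakL3_backward_holds`. -/
theorem row_A2e_excluded : Row_A2e :=
  FluidPDE.AlbrittonBarker2019_liouville_weakL3_backward_holds

/-- Census row A2d — (any type · no symmetry · bounded weak ancient solution in a Ladyzhenskaya–Prodi–Serrin
class `L^l_t L^s_x`, `3/s + 2/l = 1`, `s > 3`): `u ≡ 0`, BY NAME the fact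
`Seregin2014_ancient_liouville_LPS`. Value: EXCLUDED-IN-TREE. -/
def Row_A2d : Prop :=
  FluidPDE.Seregin2014_ancient_liouville_LPS

/-- A2d is EXCLUDED-IN-TREE: `Seregin2014_ancient_liouville_LPS_holds`. -/
theorem row_A2d_excluded : Row_A2d :=
  FluidPDE.Seregin2014_ancient_liouville_LPS_holds

/-- Census row A3 — (any type · axisymmetric WITHOUT swirl · bounded ancient mild): slices a.e. `β(t) e_z`
(KNSS 2009 Thm 5.2), BY NAME the fact `knss_axisymmetric_no_swirl`. Value: EXCLUDED-IN-TREE. -/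
def Row_A3 : Prop :=
  FluidPDE.knss_axisymmetric_no_swirl

/-- A3 is EXCLUDED-IN-TREE: `knss_axisymmetric_no_swirl_holds`. -/
theorem row_A3_excluded : Row_A3 :=
  FluidPDE.knss_axisymmetric_no_swirl_holds

/-- Census row A4 — (any type · axisymmetric with `r ‖u‖ ≤ C` · bounded ancient mild): `u ≡ 0`
(KNSS 2009 Thm 5.3), BY NAME the fact `knss_bound_C_over_r`. Value: EXCLUDED-IN-TREE. -/
def Row_A4 : Prop :=
  FluidPDE.knss_bound_C_over_r

/-- A4 is EXCLUDED-IN-TREE: `knss_bound_C_over_r_holds`. -/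
theorem row_A4_excluded : Row_A4 :=
  FluidPDE.knss_bound_C_over_r_holds

/-- Census row A5 — (any type · axisymmetric WITH swirl, `Γ = r u_θ` bounded · bounded ancient mild):
slices a.e. constant, BY NAME the canonical leaf `AxisymmetricLiouvilleBoundedSwirl` (KNSS 2009 §5 open
problem, Lei–Ren–Zhang form). Value: OPEN-NO-LINE (only the dormant item ⟨2003⟩). -/
def Row_A5 : Prop :=
  Summit.NavierStokesRegularity.NavierStokesRegularity.AxisymmetricLiouvilleBoundedSwirl

/-- A1 ⇒ A5 (tree theorem `LiouvilleConjectureNS.axisymmetricLiouvilleBoundedSwirl`). -/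
theorem row_A5_of_row_A1 (h : Row_A1) : Row_A5 :=
  FluidPDE.LiouvilleConjectureNS.axisymmetricLiouvilleBoundedSwirl h

/-- Census row A5a — A5 with `Γ ∈ L^∞_t L^p_x`, `p < ∞` (Lei–Zhang–Zhao 2017 Thm 1.3), BY NAME the fact
`leiZhangZhao2017_liouville_swirl_Lp`. Value: EXCLUDED-IN-TREE. -/
def Row_A5a : Prop :=
  FluidPDE.leiZhangZhao2017_liouville_swirl_Lp

/-- A5a is EXCLUDED-IN-TREE: `leiZhangZhao2017_liouville_swirl_Lp_holds`. -/
theorem row_A5a_excluded : Row_A5a :=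
  FluidPDE.leiZhangZhao2017_liouville_swirl_Lp_holds

/-- Census row A5b — A5 with `Γ → 0` as `r → ∞` uniformly (Lei–Zhang–Zhao 2017 Rem. 1.4), BY NAME the
fact `leiZhangZhao2017_liouville_swirl_decay`. Value: EXCLUDED-IN-TREE. -/
def Row_A5b : Prop :=
  FluidPDE.leiZhangZhao2017_liouville_swirl_decay

/-- A5b is EXCLUDED-IN-TREE: `leiZhangZhao2017_liouville_swirl_decay_holds`. -/
theorem row_A5b_excluded : Row_A5b :=
  FluidPDE.leiZhangZhao2017_liouville_swirl_decay_holds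

/-- Census row A5c — A5 under the Lei–Ren–Zhang rate condition `|Γ² − L²| ≤ ε₀L²/r` (arXiv:1902.11229
Thm 1.2), BY NAME the fact `leiRenZhang2019_liouville_swirl_rate`. Value: EXCLUDED-IN-TREE. -/
def Row_A5c : Prop :=
  FluidPDE.leiRenZhang2019_liouville_swirl_rate

/-- A5c is EXCLUDED-IN-TREE: `leiRenZhang2019_liouville_swirl_rate_holds`. -/
theorem row_A5c_excluded : Row_A5c :=
  FluidPDE.leiRenZhang2019_liouville_swirl_rate_holds

/-- Census row A5d — A5-type cell with bounded `Γ` and a `BMO` stream function, bounded WEAK ancient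
class (Lei–Zhang 2011 Thm 1.2 ⇒ `u ≡ 0`), BY NAME the fact `LeiZhang2011_liouville`.
Value: EXCLUDED-IN-TREE. -/
def Row_A5d : Prop :=
  FluidPDE.LeiZhang2011_liouville

/-- A5d is EXCLUDED-IN-TREE: `LeiZhang2011_liouville_holds`. -/
theorem row_A5d_excluded : Row_A5d :=
  FluidPDE.LeiZhang2011_liouville_holds

/-- Census row A5e — A5 periodic in `z` (Lei–Ren–Zhang, Math. Ann. 383 (2022): axisymmetric bounded
ancient mild on `ℝ² × 𝕋¹`, bounded `Γ`), BY NAME the fact `leiRenZhang2019_liouville_periodic`.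
Value: EXCLUDED-IN-TREE. -/
def Row_A5e : Prop :=
  FluidPDE.leiRenZhang2019_liouville_periodic

/-- A5e is EXCLUDED-IN-TREE: `leiRenZhang2019_liouville_periodic_holds`. -/
theorem row_A5e_excluded : Row_A5e :=
  FluidPDE.leiRenZhang2019_liouville_periodic_holds

/-- Census row A6 — (any type · planar, two space dimensions · bounded weak ancient): `u(t,x) = b(t)`
(KNSS 2009 Thm 5.1), BY NAME the printed-class fact `KNSS2009_liouville_planar` (vorticity form:
`gigaMiura2011_planar_vorticity_liouville_holds`). Value: EXCLUDED-IN-TREE. The 2.5D cell A7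
(x₃-independent three-component fields) and the helical cell A8 have no tree predicate (markdown only). -/
def Row_A6 : Prop :=
  FluidPDE.KNSS2009_liouville_planar

/-- A6 is EXCLUDED-IN-TREE: `KNSS2009_liouville_planar_holds`. -/
theorem row_A6_excluded : Row_A6 :=
  FluidPDE.KNSS2009_liouville_planar_holds

/-- Census row A9 (regularity side) — (any type · a FINITE set `G` of linear isometries of `ℝ³` with no
common non-zero fixed vector · bounded ancient mild): every bounded ancient mild solution with measurable
slices which is `G`-equivariant (`u(t, g x) = g u(t, x)` a.e., all `g ∈ G`, `t < 0`) vanishes a.e. on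
every slice. The polyhedral / orthant (`B₃`) classes of the census are such `G`. Value: OPEN-NO-LINE
(negative side: route QuantisedSymmetry); implied by A1 (`row_A9_of_row_A1`). -/
def Row_A9 : Prop :=
  ∀ G : Set (EuclideanSpace ℝ (Fin 3) ≃ₗᵢ[ℝ] EuclideanSpace ℝ (Fin 3)), G.Finite →
    (∀ v : EuclideanSpace ℝ (Fin 3), (∀ g ∈ G, g v = v) → v = 0) →
      ∀ u : ℝ → EuclideanSpace ℝ (Fin 3) → EuclideanSpace ℝ (Fin 3),
        FluidPDE.IsBoundedAncientMildSolution 1 u → (∀ t < 0, AEStronglyMeasurable (u t) volume) →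
          (∀ g ∈ G, ∀ t < 0, (fun x => u t (g x)) =ᵐ[volume] fun x => g (u t x)) →
            ∀ t < 0, u t =ᵐ[volume] 0

/-- A1 ⇒ A9: under (L) the slice is a.e. a constant `b`; equivariance and the invariance of Lebesgue
measure under linear isometries (`LinearIsometryEquiv.measurePreserving`) give `g b = b` for all
`g ∈ G`, hence `b = 0`. Finiteness of `G` is carried, not used. -/
theorem row_A9_of_row_A1 (h : Row_A1) : Row_A9 := by
  intro G _ hfix u hu hmeas hequi t ht
  obtain ⟨b, hb⟩ := h u hu hmeas t ht
  have hgb : ∀ g ∈ G, g b = b := by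
    intro g hg
    have h1 : (fun x => u t (g x)) =ᵐ[volume] fun _ => b :=
      (g.measurePreserving).quasiMeasurePreserving.ae_eq_comp hb
    have h2 : (fun x => g (u t x)) =ᵐ[volume] fun _ => g b :=
      hb.mono fun x hx => by simp [hx]
    have h3 : (fun _ : EuclideanSpace ℝ (Fin 3) => b) =ᵐ[volume]
        fun _ : EuclideanSpace ℝ (Fin 3) => g b :=
      (h1.symm.trans (hequi g hg t ht)).trans h2
    have h4 : ∀ᵐ _ : EuclideanSpace ℝ (Fin 3) ∂volume, b = g b := h3
    haveI : (ae (volume : Measure (EuclideanSpace ℝ (Fin 3)))).NeBot := ae_neBot.2 (NeZero.ne _)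
    exact (Filter.eventually_const.1 h4).symm
  have hb0 : b = 0 := hfix b hgb
  rw [hb0] at hb
  exact hb

/-- Census row A10a — ((near-)Beltrami steady Euler profile · decay `‖x‖ ‖v(x)‖ → 0`): a `C¹`
divergence-free Beltrami field `curl v = λ v` with `|v(x)| = o(|x|⁻¹)` vanishes (Nadirashvili 2014;
Chae–Wolf 2016 Rem. 1.4 (i)); over the tree predicate `IsBeltrami` (λ a function). Value: EXCLUDED-IN-TREE.
(Sharp: Enciso–Peralta-Salas Beltrami fields decay exactly like `1/|x|`; bounded NON-decaying steady
viscous Beltrami fields with constant `λ ≠ 0` are trivially `0`.) -/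
def Row_A10a : Prop :=
  ∀ (v : EuclideanSpace ℝ (Fin 3) → EuclideanSpace ℝ (Fin 3)) (lam : EuclideanSpace ℝ (Fin 3) → ℝ),
    FluidPDE.IsBeltrami v lam → ContDiff ℝ 1 v → FluidPDE.VectorCalculus.IsDivFree v →
      Tendsto (fun x : EuclideanSpace ℝ (Fin 3) => ‖x‖ * ‖v x‖)
        (cocompact (EuclideanSpace ℝ (Fin 3))) (𝓝 0) → v = 0

/-- A10a is EXCLUDED-IN-TREE: `IsBeltrami.eq_zero_of_norm_mul_norm_tendsto_zero`. -/
theorem row_A10a_excluded : Row_A10a :=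
  fun _ _ h hv hdiv hdec => h.eq_zero_of_norm_mul_norm_tendsto_zero hv hdiv hdec

/-- Census row A10b — ((near-)Beltrami steady Euler profile · `v ∈ L^q(ℝ³)`, `2 ≤ q ≤ 3`): a `C¹`
divergence-free Beltrami field with `∫ ‖v‖^q < ∞` vanishes (Nadirashvili 2014; Chae–Wolf 2016 Rem. 1.4
(ii); `q = 2` = finite energy, Chae–Constantin 2015). Value: EXCLUDED-IN-TREE. -/
def Row_A10b : Prop :=
  ∀ (v : EuclideanSpace ℝ (Fin 3) → EuclideanSpace ℝ (Fin 3)) (lam : EuclideanSpace ℝ (Fin 3) → ℝ),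
    FluidPDE.IsBeltrami v lam → ContDiff ℝ 1 v → FluidPDE.VectorCalculus.IsDivFree v →
      ∀ q : ℝ, 2 ≤ q → q ≤ 3 → Integrable (fun x : EuclideanSpace ℝ (Fin 3) => ‖v x‖ ^ q) → v = 0

/-- A10b is EXCLUDED-IN-TREE: `IsBeltrami.eq_zero_of_integrable_norm_rpow`. -/
theorem row_A10b_excluded : Row_A10b :=
  fun _ _ h hv hdiv _ hq2 hq3 hint => h.eq_zero_of_integrable_norm_rpow hv hdiv hq2 hq3 hint

/-- Census row A11 — (Type-II zoom object · no symmetry · finite-energy power-gauged ancient EULER solution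
on the slab `ℝ³ × (−∞,0)`): it vanishes, BY NAME the route item
`EulerZoomLiouville.PowerGaugeEulerLiouville` (⟨19832⟩; Seregin 2023/2026 Euler-zoom scenario; the only
cell attacking Type II through a limit object other than A1). Value: OPEN-WITH-LINE (mechanism row EZL). -/
def Row_A11 : Prop :=
  Summit.NavierStokesRegularity.NavierStokesRegularity.Theses.EulerZoomLiouville.PowerGaugeEulerLiouville

/-- Census row A12 — (any type · no symmetry · bounded ancient mild, smooth, UNIFORMLY BOUNDED ENSTROPHY,
`L⁶` slices): the parabolic Galdi–Liouville statement, BY NAME the route item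
`GaldiLiouvilleGate.ParabolicGaldiLiouville` (⟨0893⟩, hard core; between A1 and the steady row S1 of
`ScenarioCensusSteady.lean`; known cases `…Birth.parabolicGaldiLiouville_axisymmetric_noSwirl`,
`…_axisymmetric_bound_C_over_r` = census S1c). Value: OPEN-WITH-LINE. -/
def Row_A12 : Prop :=
  Summit.NavierStokesRegularity.NavierStokesRegularity.Theses.GaldiLiouvilleGate.ParabolicGaldiLiouville

/-- A1 ⇒ A12 (tree theorem `Theorems.ParabolicGaldiLiouville.Birth.parabolicGaldiLiouville_of_liouvilleConjectureNS`). -/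
theorem row_A12_of_row_A1 (h : Row_A1) : Row_A12 :=
  ParabolicGaldiLiouville.Birth.parabolicGaldiLiouville_of_liouvilleConjectureNS h

/-! ## Appendix 1 (append-only round 2): printed-class twins of A3 / A4 / A6

The KNSS theorems as PRINTED concern bounded WEAK solutions on `ℝ³ × (−∞,0)` (`IsBoundedWeakNSSolutionOn`,
jointly measurable `L^∞` class, a.e. hypotheses) rather than the bounded ancient MILD class of A3/A4; the
census cell "bounded ancient weak / mild" is covered by both renderings. -/

/-- Census row A3b — printed-class twin of A3 (any type · axisymmetric WITHOUT swirl a.e. · bounded WEAK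
ancient solution, KNSS 2009 Thm 5.2 verbatim: `u(t) = b(t) e_z` a.e. for a.e. `t < 0`), BY NAME the
fact `KNSS2009_liouville_axisymmetric_no_swirl`. Value: EXCLUDED-IN-TREE. -/
def Row_A3b : Prop :=
  FluidPDE.KNSS2009_liouville_axisymmetric_no_swirl

/-- A3b is EXCLUDED-IN-TREE: `KNSS2009_liouville_axisymmetric_no_swirl_holds`. -/
theorem row_A3b_excluded : Row_A3b :=
  FluidPDE.KNSS2009_liouville_axisymmetric_no_swirl_holds

/-- Census row A4b — printed-class twin of A4 (any type · axisymmetric with `|u| ≤ C/r` · bounded WEAK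
ancient solution, KNSS 2009 Thm 5.3 verbatim: `u = 0`), BY NAME the fact
`KNSS2009_liouville_bound_C_over_r`. Value: EXCLUDED-IN-TREE. -/
def Row_A4b : Prop :=
  FluidPDE.KNSS2009_liouville_bound_C_over_r

/-- A4b is EXCLUDED-IN-TREE: `KNSS2009_liouville_bound_C_over_r_holds`. -/
theorem row_A4b_excluded : Row_A4b :=
  FluidPDE.KNSS2009_liouville_bound_C_over_r_holds

/-- Census row A6b — vorticity form of the planar cell A6 (smooth bounded ancient planar velocity `u`
and vorticity `ω = curl u` with bounded derivatives-free class of the tree rendering, solving the 2D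
vorticity equation): `ω ≡ 0` (Giga–Miura 2011 Lemma 2.3; KNSS Thm 5.1 proof), BY NAME the fact
`gigaMiura2011_planar_vorticity_liouville`. Value: EXCLUDED-IN-TREE. -/
def Row_A6b : Prop :=
  FluidPDE.gigaMiura2011_planar_vorticity_liouville

/-- A6b is EXCLUDED-IN-TREE: `gigaMiura2011_planar_vorticity_liouville_holds`. -/
theorem row_A6b_excluded : Row_A6b :=
  FluidPDE.gigaMiura2011_planar_vorticity_liouville_holds

/-- Census row A6c (v1.9; append-only round 3) — (any type, all space derivatives bounded · vorticity
UNIDIRECTIONAL at each time, `curl v(t,x) = ‖curl v(t,x)‖ ζ₀(t)` · smooth Oseen-mild ancient, `ν = 1`,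
weakly div-free slices; Giga–Miura 2011 Prop. 2.2, strictly wider than A6): RIGIDITY `curl v ≡ 0`,
BY NAME the fact `gigaMiura2011_unidirectional_vorticity_eq_zero`. Value: EXCLUDED-IN-TREE. -/
def Row_A6c : Prop :=
  FluidPDE.gigaMiura2011_unidirectional_vorticity_eq_zero

/-- A6c is EXCLUDED-IN-TREE: `gigaMiura2011_unidirectional_vorticity_eq_zero_holds`. -/
theorem row_A6c_excluded : Row_A6c :=
  FluidPDE.gigaMiura2011_unidirectional_vorticity_eq_zero_holds

end Summit.NavierStokesRegularity.NavierStokesRegularity.Theorems.ScenarioCensus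

end
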